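import Literature.NumberTheory.IwasawaTheory.Greenberg2006.GlobalEulerPoincareCorank
import Literature.NumberTheory.IwasawaTheory.Greenberg2006.CorankEulerCharacteristicStep
import Literature.NumberTheory.IwasawaTheory.Greenberg2006.CohomologyCofiniteGenerationOfPoitouTate
import HarnessLib

/-!
# Greenberg 2006, Prop. 4.1 — the GLOBAL Euler–Poincaré `Λ`-corank formula HOLDS modulo three
# textbook facts: Tate's global Euler characteristic (Milne I Thm. 5.1) and Poitou–Tate
# (Harari Thm. 17.13 (a), Cor. 17.17)

Topic `NumberTheory/IwasawaTheory/Greenberg2006`; namespace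
`Literature.NumberTheory.IwasawaTheory.Greenberg2006`.  THEOREMS ONLY (no definition, no named
fact, no `sorry`, no instance).

Greenberg, *On the structure of certain Galois cohomology groups* (Doc. Math. 2006), Prop. 4.1
(p. 367 L40 – p. 368 L1): "`Σ_{i=0}^{2} (−1)^i corank_Λ(Hⁱ(K_Σ/K, 𝒟)) = −δ_Λ(K, 𝒟)` where
`δ_Λ(K, 𝒟) = r₂m + Σ_{v real} m_v^−`"; typed (`prop41_globalEulerPoincareCorank`) for `K` totally
imaginary.  Print's proof (p. 368): "specialisation" to Krull dimension `1`, then to finite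
modules, where the formula is Tate's global Euler characteristic and `Hⁱ = 0` for `i ≥ 3` is
Poitou–Tate.  In the tree:

* the Krull-dimension induction: `corankEuler_of_step_of_finiteEuler`
  (`CorankEulerCharacteristicInduction.lean`), its one-prime step
  `corankStep_of_finiteCoefficients` (`CorankEulerCharacteristicStep.lean`, on the cohomological
  engine `ContinuousCohomologyCorankModPrime.lean`), assembled at `G_{K,S}` by
  `prop41_of_step_of_tateGlobalEulerPoincareCharacteristic` (`GlobalEulerPoincareCorank.lean`);
* (E) Tate: `GaloisCohomology.natCard_H_euler_of_forall_isComplex` ⟸ the named fact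
  `tateGlobalEulerPoincareCharacteristic K` (Milne I Thm. 5.1);
* (F) finiteness: `GaloisCohomology.finite_continuousCohomology_of_prime` ⟸ the named fact
  `finite_restrictedCohomology K` (Harari Cor. 17.17 = NSW (8.3.20) = Milne I Cor. 4.15);
* (V) `H^q(G_{K,S}, ·) = 0` for `q ≥ 3`, `K` totally imaginary:
  `subsingleton_H_of_two_lt_of_poitouTate_at` ⟸ the named fact `poitouTate_restricted_three_le K`
  (Harari Thm. 17.13 (a) = Milne I Thm. 4.10 (c)).

Main theorems: **`prop41_of_tateGlobalEulerPoincareCharacteristic`** —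
`(∀ K, tateGlobalEulerPoincareCharacteristic K) → (∀ K, poitouTate_restricted_three_le K) →
(∀ K, finite_restrictedCohomology K) → prop41_globalEulerPoincareCorank`; and, with Cor. 17.17
itself reduced to Thm. 17.13 (a)+(b) (`finite_restrictedCohomology_of_poitouTate`),
**`prop41_of_tate_of_poitouTate`** — `(∀ K, tate… K) → (∀ K, poitouTate_shaRestricted_tateDual K) →
(∀ K, poitouTate_restricted_three_le K) → prop41_globalEulerPoincareCorank`.

## References
* R. Greenberg, *On the structure of certain Galois cohomology groups*, Doc. Math. Extra Vol.
  Coates (2006) 335–391, §4 A Prop. 4.1 (p. 367 L40 – p. 368 L1) and its proof (p. 368).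
  [Greenberg2006]
* J. S. Milne, *Arithmetic Duality Theorems*, 2nd ed. (2006), I Thm. 5.1 (p. 67), I Thm. 4.10,
  I Cor. 4.15. [MilneADT2006]
* D. Harari, *Galois Cohomology and Class Field Theory* (2020), Thm. 17.13, Cor. 17.17. [Harari2020]
-/

noncomputable section

open scoped Classical
open NumberField IsDedekindDomain Field
open Literature.NumberTheory.GaloisRepresentations
open Literature.NumberTheory.GaloisCohomology
open Literature.NumberTheory.IwasawaTheory.Greenberg2016

namespace Literature.NumberTheory.IwasawaTheory.Greenberg2006

/-- **Greenberg 2006, Prop. 4.1 (`prop41_globalEulerPoincareCorank`) from Tate's global Euler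
characteristic, `Hʳ(G_S, ·) ≅ ⊕_{v real}` (`r ≥ 3`) and finiteness of `Hʳ(G_S, finite)`** — the named
fact at its binders, GRANTED the three textbook named facts `tateGlobalEulerPoincareCharacteristic`
(Milne I Thm. 5.1), `poitouTate_restricted_three_le` (Harari Thm. 17.13 (a)) and
`finite_restrictedCohomology` (Harari Cor. 17.17), for every number field.
[cite: Greenberg2006, Prop. 4.1 (§4 A, p. 367 L40 – p. 368 L1) and its proof (p. 368)]
[cite: MilneADT2006, I Thm. 5.1 (p. 67)] [cite: Harari2020, Thm. 17.13 (a), Cor. 17.17] -/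
theorem prop41_of_tateGlobalEulerPoincareCharacteristic
    (hT : ∀ (K : Type) [Field K] [NumberField K], tateGlobalEulerPoincareCharacteristic K)
    (hPTa : ∀ (K : Type) [Field K] [NumberField K], poitouTate_restricted_three_le K)
    (hPT : ∀ (K : Type) [Field K] [NumberField K], finite_restrictedCohomology K) :
    prop41_globalEulerPoincareCorank :=
  prop41_of_step_of_tateGlobalEulerPoincareCharacteristic
    (fun p _ K _ _ S hSf hSp hK =>
      corankStep_of_finiteCoefficients (Γ := GaloisGroupUnramifiedOutside K S) p
        (fun _ _ _ _ _ _ _ _ _ _ τ hp n =>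
          finite_continuousCohomology_of_prime S τ (hPT K) hSf p hSp hp n)
        (fun _ _ _ _ _ _ _ _ _ _ τ hp _ hq =>
          subsingleton_H_of_two_lt_of_poitouTate_at (hPTa K) hK hSp τ hp hq))
    hT hPT

/-- **The same with every input a ROOT Poitou–Tate / Tate fact**: Cor. 17.17 (finiteness) is
itself a tree theorem modulo Thm. 17.13 (a)+(b) (`finite_restrictedCohomology_of_poitouTate`), so
Greenberg 2006 Prop. 4.1 rests on {Milne I Thm. 5.1, Harari Thm. 17.13 (a), Harari Thm. 17.13 (b)}.
[cite: Greenberg2006, Prop. 4.1 (§4 A, p. 367 L40 – p. 368 L1)] [cite: MilneADT2006, I Thm. 5.1 (p. 67)]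
[cite: Harari2020, Thm. 17.13 (a), (b)] -/
theorem prop41_of_tate_of_poitouTate
    (hT : ∀ (K : Type) [Field K] [NumberField K], tateGlobalEulerPoincareCharacteristic K)
    (hPTb : ∀ (K : Type) [Field K] [NumberField K], poitouTate_shaRestricted_tateDual K)
    (hPTa : ∀ (K : Type) [Field K] [NumberField K], poitouTate_restricted_three_le K) :
    prop41_globalEulerPoincareCorank :=
  prop41_of_tateGlobalEulerPoincareCharacteristic hT hPTa
    fun K _ _ => finite_restrictedCohomology_of_poitouTate (hPTb K) (hPTa K)

end Literature.NumberTheory.IwasawaTheory.Greenberg2006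

end
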